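import Literature.NumberTheory.EllipticCurves.Sprung2017.SharpFlatPAdicLFunction
import Literature.NumberTheory.EllipticCurves.QuadraticTwist
import Literature.NumberTheory.EllipticCurves.Rank1Residual.Typed.Basic
import Summits.BirchSwinnertonDyer.Rank1Residual.X1.MuLambdaAlgebra
import HarnessLib

/-!
# Cell `bsd-f1-sign2` (`p = 2`, non-CM) — analytic lens (seat `-an`), candidate AN-5 `BlindOrderAtChi8`:
# the ORDER of the Sprung pair `(L♯, L♭)` at the ORDER-2 CHARACTER `T = −2` against the analytic rank of
# the `χ₈`-twist — `ord_{−2} L♯ = r₂`, `ord_{−2} L♭ = |r₂ − 1|` (♭ is blind at `χ₈`)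

HONEST FRAMING (typer seat `bsd-f1-sign2-ty`; HOME `run/shared/lean/pub/bsd-f1-sign2/`, CANDIDATES.md §2
row AN-5): STATEMENTS ONLY — one helper predicate with body (`HasOrderAtNegTwo L n`), three
`@[conjecture] def`s (OPEN obligations of ours: `BlindOrderAtChi8` conjecture-grade, its TESTED λ-shadow
`SignedLambdaBoundsAtChi8`, the bookkeeping `BlindZeroSimpleIff`) and two proved numerical lemmas; nothing
asserted, nothing booked, no named fact, PARTITION: none moved. Source: `HOME/MEMO-an-data/Sketch.lean` v2
sha16 59844b141506c32a §AN-5 (planner bsd-f1-sign2-an g1, rc 0; idea card MEMO-an-data/idea-blind-order-at-chi8.md),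
bodies re-filed VERBATIM (namespace moved to the cell's `…Rank1Residual.F1Sign2`). REFUTER PASS: REF1-AUDIT-v1.md §8.2 (batch 2, 2026-08-27T15:06Z, file sha16 e1bf27aeee759c96): every v2 decl of this file **SURVIVES** (11/11 -an v2 closed Props A1 rc 0, BC7 LIBRARY-SEARCH-ON CLEAN; typing suggestions non-blocking, recorded in CANDIDATES.md §2). REF2 on the v2 rows: pending at filing.

MATHEMATICS (MEMO-an v1.2 §AN-5): at `p = 2` the involution `T ↦ (1+T)⁻¹ − 1` of the open disc has exactly
two fixed points, `T = 0` and `T = −2` (the character `γ ↦ −1`, layer `ℚ₁ = ℚ(√2)`, Dirichlet `χ₈`); every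
other zero of a power series satisfying the scalar ♯/♭ functional equation at `a₂ = 0` (tree
`exists_functionalEquation_sharp_flat_two`) comes with its partner, so `λ = ord₀ + ord₋₂ + 2k`. The tree
knows the VALUES at `−2` (`coe_evalAt_sharp_neg_two_eq`: `L♯(−2) = −θ₁(−2) ∝ L(E ⊗ χ₈, 1)`;
`BlindFlat.flatLaw_evalAt_neg_two_of_rootNumber`: `L♭(−2) = 0` forced when `w_E χ₈(N_E) = +1`, the
"blind point") and the parities of `λ♯`, `λ♭`. AN-5 is the ORDER law behind them: with `E₂ = E ⊗ χ₈` and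
`r₂ = r_an(E₂)`, `ord_{T=−2} L♯ = r₂` (♯ interpolates at `χ₈`: Kummer condition, honest `2`-adic BSD at
the character) and `ord_{T=−2} L♭ = |r₂ − 1|` (♭ is blind at `χ₈`: its `χ₈`-local condition is the
Lagrangian transverse to `H¹_f(ℚ₂, V E₂)`, so the Selmer corank is `1` at `r₂ = 0` and DROPS to `r₂ − 1`
for every `r₂ ≥ 1`). Habitat: `a₂ = 0` (scalar functional equation); for `a₂ = ±2` the ♭-value at `−2`
interpolates (`blindInterpolation_flat`, `e = 2`) and the law is different — not claimed.

BC5 WITNESS / CHEAPEST FALSIFIER (run, -an g1: `MEMO-an-data/an5_twistrank.py` e52dd36da3d6912f →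
`an5_twistrank_out.json` 5aea2fd6c7a0bb65; SF2-ALL × Cremona allbsd, `64N < 5·10⁵`, twist `E^{(2)}` of
conductor `64N` identified by `j` + `c₆` on 1 689/1 689 rows, sanity `(−1)^{r₂} = w₈` and
`[r₂ > 0] = [θ₁(−2) = 0]` 1 689/1 689): the λ-shadow holds on **813/813** `a₂ = 0` rows with **0 violations**
of `λ♭ ≥ r + |r₂−1|`, `λ♯ ≥ r + r₂`, every excess EVEN; equality 521/813 (♭), 289/813 (♯); the rival
"overshoot" law `ord₋₂ L♭ = r₂ + 1` is REFUTED by 13/16 rank-0 rows with `r₂ = 2` and certified `λ♭ = 1`.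
NOT KILLED. WHY IT MIGHT FAIL: semisimplicity of `X^±` at `(T+2)` (a `2`-adic height at the `χ₈`-point) or
the `loc₂ ≠ 0` step for `r₂ ≥ 1`. WHY NOVEL: nothing in print at supersingular `2` on the ORDER at `χ₈`
(bsd-2adic eng-2 CERT-SS-ORDER2-E2 tests only the `r(W) = 0` VALUE species P0/P1/P2).

References: [Sprung2017] Thm. 1.12, Cor. 4.4 (`IsSprungPair`); [KuriharaOtsuki2006] Prop. 1.3 / Cor. 1.2
(layer `ℚ(√2)`); HOME MEMO-an.md v1.2, MEMO-an-data/Sketch.lean 59844b141506c32a, idea-blind-order-at-chi8.md.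
-/

set_option autoImplicit false

noncomputable section

open scoped Classical MatrixGroups ModularForm

open CongruenceSubgroup Polynomial WeierstrassCurve Literature.NumberTheory.EllipticCurves
  Literature.NumberTheory.EllipticCurves.ModularForms Literature.NumberTheory.EllipticCurves.Sprung2017
  Literature.NumberTheory.EllipticCurves.Rank1Residual Summit.BirchSwinnertonDyer.Rank1Residual.X1.MuLambda

namespace Summit.BirchSwinnertonDyer.Rank1Residual.F1Sign2

/-- **Order of vanishing `n` of `L ∈ Λ = ℤ₂⟦T⟧` at the order-2 character `T = −2`** (`T + 2` is prime in
`Λ`, tree `prime_X_add_C_two`): `(T+2)^n ∣ L` and `(T+2)^{n+1} ∤ L`. Helper predicate (parameters explicit),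
not a candidate; nothing asserted. [folklore] -/
def HasOrderAtNegTwo (L : IwasawaAlgebra 2) (n : ℕ) : Prop :=
  (PowerSeries.X + PowerSeries.C (2 : ℤ_[2])) ^ n ∣ L ∧
    ¬ (PowerSeries.X + PowerSeries.C (2 : ℤ_[2])) ^ (n + 1) ∣ L

/-- Unfolding lemma for `HasOrderAtNegTwo`. [folklore] -/
theorem hasOrderAtNegTwo_iff (L : IwasawaAlgebra 2) (n : ℕ) :
    HasOrderAtNegTwo L n ↔
      (PowerSeries.X + PowerSeries.C (2 : ℤ_[2])) ^ n ∣ L ∧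
        ¬ (PowerSeries.X + PowerSeries.C (2 : ℤ_[2])) ^ (n + 1) ∣ L :=
  Iff.rfl

/-- **CANDIDATE AN-5 `BlindOrderAtChi8` (conjecture-grade; new in -an v2): order law at the order-2
character.** For `W` good supersingular at `2` with `a₂ = 0`, newform `f`, EVERY Sprung pair `(L♯, L♭)` of
`f` at `2`, and `W₂` a model of `W ⊗ χ₈` with `r₂ := r_an(W₂)`: `ord_{−2} L♯ = r₂` and
`ord_{−2} L♭ = |r₂ − 1|`. Witness: λ-shadow 813/813, 0 violations, every excess even; rival overshoot law
refuted 13/16. [folklore] -/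
@[conjecture] def BlindOrderAtChi8 : Prop :=
  ∀ {N : ℕ} [NeZero N] (f : CuspForm (Gamma0 N) 2) (W : WeierstrassCurve ℚ) [W.IsElliptic] [W.IsGloballyMinimal]
    (W₂ : WeierstrassCurve ℚ) [W₂.IsElliptic] (Lsharp Lflat : IwasawaAlgebra 2),
    IsNewformOf W f → GoodSS W 2 → W.frobeniusTrace 2 = 0 →
    IsSprungPair f 2 (W.frobeniusTrace 2) Lsharp Lflat →
    (∃ C : WeierstrassCurve.VariableChange ℚ, C • W.quadraticTwist 2 = W₂) →
    HasOrderAtNegTwo Lsharp W₂.analyticRank ∧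
      HasOrderAtNegTwo Lflat (((W₂.analyticRank : ℤ) - 1).natAbs)

/-- **AN-5λ `SignedLambdaBoundsAtChi8` (the TESTED shadow of AN-5 + "ord₀ ≥ r_an(W)" + the pairing of the
other zeros; conjecture-grade, refutable row by row from certified `μ = 0` / `λ` readings):**
`λ♯ = r + r₂ + 2k` and `λ♭ = r + |r₂ − 1| + 2k′` with `r = r_an(W)`, `r₂ = r_an(W ⊗ χ₈)`. Census (BC5
witness): 813 `a₂ = 0` rows (CTRL ∪ VAL of SF2-ALL, all ranks `r ≤ 2`): violations 0, odd excess 0. The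
`μ = 0` binders are the open `μ`-statement at `2` (REF1 on C-C), carried, not claimed; `L ≠ 0` excludes the
`lam 0` junk value. [folklore] -/
@[conjecture] def SignedLambdaBoundsAtChi8 : Prop :=
  ∀ {N : ℕ} [NeZero N] (f : CuspForm (Gamma0 N) 2) (W : WeierstrassCurve ℚ) [W.IsElliptic] [W.IsGloballyMinimal]
    (W₂ : WeierstrassCurve ℚ) [W₂.IsElliptic] (Lsharp Lflat : IwasawaAlgebra 2),
    IsNewformOf W f → GoodSS W 2 → W.frobeniusTrace 2 = 0 →
    IsSprungPair f 2 (W.frobeniusTrace 2) Lsharp Lflat →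
    (∃ C : WeierstrassCurve.VariableChange ℚ, C • W.quadraticTwist 2 = W₂) →
    Lsharp ≠ 0 → Lflat ≠ 0 → mu Lsharp = 0 → mu Lflat = 0 →
    (∃ k : ℕ, lam Lsharp = W.analyticRank + W₂.analyticRank + 2 * k) ∧
      (∃ k : ℕ, lam Lflat = W.analyticRank + (((W₂.analyticRank : ℤ) - 1).natAbs) + 2 * k)

/-- **AN-5 bookkeeping `BlindZeroSimpleIff`: the forced ♭-zero at `−2` is SIMPLE exactly when the twist has
analytic rank `0` or `2`** — the form in which the 13 + 48 rank-0 rows with certified `λ♭ = 1` witness AN-5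
(expected provable from AN-5 and the definitions). [folklore] -/
@[conjecture] def BlindZeroSimpleIff : Prop :=
  ∀ {N : ℕ} [NeZero N] (f : CuspForm (Gamma0 N) 2) (W : WeierstrassCurve ℚ) [W.IsElliptic] [W.IsGloballyMinimal]
    (W₂ : WeierstrassCurve ℚ) [W₂.IsElliptic] (Lsharp Lflat : IwasawaAlgebra 2),
    IsNewformOf W f → GoodSS W 2 → W.frobeniusTrace 2 = 0 →
    IsSprungPair f 2 (W.frobeniusTrace 2) Lsharp Lflat →
    (∃ C : WeierstrassCurve.VariableChange ℚ, C • W.quadraticTwist 2 = W₂) →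
    (HasOrderAtNegTwo Lflat 1 ↔ (W₂.analyticRank = 0 ∨ W₂.analyticRank = 2))

/-- Bookkeeping check (proved): AN-5's ♭-exponent is `1` at `r₂ = 0`, `0` at `r₂ = 1`, `1` at `r₂ = 2`,
`2` at `r₂ = 3` — the "drop" law, not the overshoot `r₂ + 1`. [folklore] -/
theorem flatExponent_values :
    (((0 : ℕ) : ℤ) - 1).natAbs = 1 ∧ (((1 : ℕ) : ℤ) - 1).natAbs = 0 ∧
      (((2 : ℕ) : ℤ) - 1).natAbs = 1 ∧ (((3 : ℕ) : ℤ) - 1).natAbs = 2 := by decide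

/-- Bookkeeping (proved): `|r₂ − 1| = 1 ↔ r₂ = 0 ∨ r₂ = 2` (the numerical content of `BlindZeroSimpleIff`
given AN-5). [folklore] -/
theorem natAbs_sub_one_eq_one_iff (r : ℕ) : (((r : ℤ) - 1).natAbs = 1) ↔ (r = 0 ∨ r = 2) := by
  omega

/-- AN-5 ⇒ `BlindZeroSimpleIff` (proved: uniqueness of the order at the prime `T + 2` is not needed — AN-5
pins the ♭-order to `|r₂ − 1|`, and `HasOrderAtNegTwo L 1 ∧ HasOrderAtNegTwo L n → n = 1` by divisibility
bookkeeping). [folklore] -/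
theorem blindZeroSimpleIff_of_blindOrderAtChi8 (h : BlindOrderAtChi8) : BlindZeroSimpleIff := by
  intro N _ f W _ _ W₂ _ Lsharp Lflat hf hss ha hSP hW₂
  have hflat := (h f W W₂ Lsharp Lflat hf hss ha hSP hW₂).2
  rw [← natAbs_sub_one_eq_one_iff]
  set n := (((W₂.analyticRank : ℤ) - 1).natAbs) with hn
  constructor
  · rintro ⟨h1, h2⟩
    obtain ⟨hn1, hn2⟩ := hflat
    -- `n ≤ 1` from `(T+2)^{n} ∣ L`, `(T+2)^2 ∤ L`; `1 ≤ n` from `(T+2) ∣ L`, `(T+2)^{n+1} ∤ L`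
    have hle : n ≤ 1 := by
      by_contra hlt
      push Not at hlt
      exact h2 (dvd_trans (pow_dvd_pow _ (by omega)) hn1)
    have hge : 1 ≤ n := by
      by_contra hlt
      push Not at hlt
      have hn0 : n = 0 := by omega
      rw [hn0, zero_add, pow_one] at hn2
      rw [pow_one] at h1
      exact hn2 h1
    omega
  · intro h1
    rw [h1] at hflat
    exact hflat

end Summit.BirchSwinnertonDyer.Rank1Residual.F1Sign2

end
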